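import Literature.NumberTheory.EllipticCurves.RootNumberTableThree
import Mathlib.NumberTheory.Padics.RingHoms
import HarnessLib

/-!
# Rizzo's Table II over `ℚ`: the bridge from the `3`-adic minimal model to the rational invariants

`Proofs` file (theorems only; no definition, no named fact) in topic
`NumberTheory/EllipticCurves`, companion of `RootNumberTableThree`, sixth file of the kernel
discharge of `WeierstrassCurve.conductorExponent_eq_tableConductorExponentThree` (cell `b2b-bsdres`,
team n1011, ROW T-PAP3).  The Kodaira symbol and `ord₃ Δ_min` of `E / ℚ` are computed in the tree on
the integral minimal model `M` of `E ⊗ ℚ₃` over Mathlib's `ℤ₃`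
(`WeierstrassCurve.conductorExponent_eq_padic`), whereas Rizzo's table is read on the invariants
`c₄, c₆, Δ ∈ ℚ` of the given equation `W` (§1.1–1.2: ANY equation, through the shift
`m = min ⌊v(Δ)/12⌋ ⌊v(c₆)/6⌋ ⌊v(c₄)/4⌋` and the prime-to-`3` parts modulo `9`).  With
`M = C • W_{ℚ₃}`, `u = C.u⁻¹`, `k = v₃(u)`: `c₄(M) = u⁴c₄`, `c₆(M) = u⁶c₆`, `Δ(M) = u¹²Δ`, so the
rational valuations are those of `M` minus `(4, 6, 12)·k`, Rizzo's shift is the LOCAL shift minus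
`k`, the reduced triple is the local one, and the prime-to-`3` parts of the rational invariants read
in `ℤ/9` are the unit parts of `M`'s invariants up to `u₀⁶ ≡ 1 (mod 9)` / `3u₀⁴ ≡ 3 (mod 9)`
(`u₀ = u·3^{-k} ∈ ℤ₃ˣ`).  This file proves exactly these bookkeeping statements:

* `addVal_toNat_eq_valuation` (`ℤ_[p]`: the DVR valuation is `PadicInt.valuation`),
  `three_dvd_sq_sub_one` (`x ∈ ℤ₃ˣ ⇒ 3 ∣ x² − 1`), `isUnit_two_padicInt_three`;
* `padicValRat_eq_of_coe_eq`, `eq_zero_iff_of_coe_eq` (valuations along `X = u^w q`);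
* `shift_sub`, `ofInvariants_eq_tableII_of_val3` (the shift absorbs `k`; the reduced triple is local);
* `toZModPow_two_primeToThreePart` (`res9 q` is the class mod `9` of `q' = q/3^{v(q)} ∈ ℤ₃ˣ`),
  `coe_eq_unitPart_mul` (unit parts along `3^e X = u^w q`), and the two `ℤ/9` facts
  `pow_six_eq_one_of_isUnit_zmod_nine`, `three_mul_pow_four_mul_of_isUnit_zmod_nine`.

## References

* O. G. Rizzo, Compositio Math. 136 (2003) 1–23, §1.1–1.2 (pp. 3–4) and Table II (p. 4). [Rizzo2003]
* J. H. Silverman, *The Arithmetic of Elliptic Curves*, 2nd ed., VII.1 (change of the invariants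
  under `u`; minimal equations). [SilvermanAEC2009]
-/

noncomputable section

open IsDiscreteValuationRing

namespace Literature.NumberTheory.EllipticCurves

namespace Rizzo

/-! ### `ℤ_[p]`: valuation, units -/

section PadicInt

variable {p : ℕ} [Fact p.Prime]

/-- On `ℤ_[p]` the DVR valuation `addVal` (in `ℕ∞`, read through `toNat`) is Mathlib's
`PadicInt.valuation` (`x = unit · p ^ valuation`, `PadicInt.unitCoeff_spec`). [cite: Gouvea1993PadicNumbers, §3.3 (ℤ_p: the valuation v_p, units, p a uniformiser, ℤ_p/pⁿℤ_p ≅ ℤ/pⁿ)] -/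
theorem addVal_toNat_eq_valuation (x : ℤ_[p]) : (addVal ℤ_[p] x).toNat = x.valuation := by
  by_cases hx : x = 0
  · subst hx; simp
  · have h : addVal ℤ_[p] x = (x.valuation : ℕ∞) :=
      addVal_def x (PadicInt.unitCoeff hx) PadicInt.irreducible_p x.valuation
        (PadicInt.unitCoeff_spec hx)
    rw [h]; rfl

/-- A `3`-adic unit is `±1 (mod 3)`: `3 ∣ x² − 1` for `x ∈ ℤ₃ˣ` (the residue field is `𝔽₃`).
[cite: Gouvea1993PadicNumbers, §3.3 (ℤ_p: the valuation v_p, units, p a uniformiser, ℤ_p/pⁿℤ_p ≅ ℤ/pⁿ)] -/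
theorem three_dvd_sq_sub_one (x : ℤ_[3]) (hx : IsUnit x) : (3 : ℤ_[3]) ∣ x ^ 2 - 1 := by
  have hz : IsUnit (PadicInt.toZMod x) := hx.map _
  have key : ∀ z : ZMod 3, (∃ w, z * w = 1) → z ^ 2 - 1 = 0 := by decide
  have h0 : PadicInt.toZMod (x ^ 2 - 1) = 0 := by
    rw [map_sub, map_pow, map_one]
    obtain ⟨w, hw⟩ := hz.exists_right_inv
    exact key _ ⟨w, hw⟩
  have hmem : x ^ 2 - 1 ∈ RingHom.ker (PadicInt.toZMod (p := 3)) := h0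
  rw [PadicInt.ker_toZMod, PadicInt.maximalIdeal_eq_span_p, Ideal.mem_span_singleton] at hmem
  exact_mod_cast hmem

/-- `2` is a unit of `ℤ₃` (`3 ∤ 2`). [cite: Gouvea1993PadicNumbers, §3.3 (ℤ_p: the valuation v_p, units, p a uniformiser, ℤ_p/pⁿℤ_p ≅ ℤ/pⁿ)] -/
theorem isUnit_two_padicInt_three : IsUnit (2 : ℤ_[3]) := by
  rw [PadicInt.isUnit_iff]
  have h1 : ‖((2 : ℤ) : ℤ_[3])‖ ≤ 1 := PadicInt.norm_le_one _
  have h2 : ¬ ‖((2 : ℤ) : ℤ_[3])‖ < 1 := by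
    rw [PadicInt.norm_int_lt_one_iff_dvd]; norm_num
  have h : ‖((2 : ℤ) : ℤ_[3])‖ = 1 := le_antisymm h1 (not_lt.mp h2)
  simpa using h

end PadicInt

/-! ### Valuations along `X = u^w · q` -/

section Valuations

variable {p : ℕ} [Fact p.Prime]

/-- If `X ∈ ℤ_[p]`, `u ∈ ℚ_pˣ` and `q ∈ ℚ` satisfy `X = u^w q` in `ℚ_p`, then `X = 0 ↔ q = 0`.
[cite: Gouvea1993PadicNumbers, §3.3 (ℤ_p: the valuation v_p, units, p a uniformiser, ℤ_p/pⁿℤ_p ≅ ℤ/pⁿ)] -/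
theorem eq_zero_iff_of_coe_eq {X : ℤ_[p]} {u : ℚ_[p]} (hu : u ≠ 0) {w : ℕ} {q : ℚ}
    (h : (X : ℚ_[p]) = u ^ w * (q : ℚ_[p])) : X = 0 ↔ q = 0 := by
  constructor
  · intro hX
    rw [hX, PadicInt.coe_zero, eq_comm, mul_eq_zero] at h
    rcases h with h | h
    · exact absurd h (pow_ne_zero _ hu)
    · exact_mod_cast h
  · intro hq
    rw [hq, Rat.cast_zero, mul_zero] at h
    exact Subtype.coe_injective (h.trans PadicInt.coe_zero.symm)

/-- If `X ∈ ℤ_[p]`, `u ∈ ℚ_pˣ` and `q ∈ ℚˣ` satisfy `X = u^w q` in `ℚ_p`, then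
`v_p(q) = v(X) − w·v(u)` (`Padic.valuation_ratCast`). [cite: Gouvea1993PadicNumbers, §3.3 (ℤ_p: the valuation v_p, units, p a uniformiser, ℤ_p/pⁿℤ_p ≅ ℤ/pⁿ)] -/
theorem padicValRat_eq_of_coe_eq {X : ℤ_[p]} {u : ℚ_[p]} (hu : u ≠ 0) {w : ℕ} {q : ℚ}
    (hq : q ≠ 0) (h : (X : ℚ_[p]) = u ^ w * (q : ℚ_[p])) :
    padicValRat p q = (X.valuation : ℤ) - w * u.valuation := by
  have hq' : (q : ℚ_[p]) ≠ 0 := by exact_mod_cast hq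
  have hv := congrArg Padic.valuation h
  rw [PadicInt.valuation_coe, Padic.valuation_mul (pow_ne_zero _ hu) hq', Padic.valuation_pow,
    Padic.valuation_ratCast] at hv
  linarith

end Valuations

/-! ### The shift absorbs `k`; the reduced triple is local -/

section Shift

/-- `KellockDokchitser.shift` is translation-equivariant: subtracting `(12, 6, 4)·k` from the
valuations subtracts `k` from the shift. [cite: Rizzo2003, §1.1 (p. 3)] -/
private theorem shift_sub (c k : ℤ) (b a : WithTop ℤ) :
    KellockDokchitser.shift (c - 12 * k) (b.map fun n => n - 6 * k) (a.map fun n => n - 4 * k) =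
      KellockDokchitser.shift c b a - k := by
  unfold KellockDokchitser.shift
  cases b with
  | top =>
    cases a with
    | top => simp only [WithTop.map_top]; omega
    | coe n => simp only [WithTop.map_top, WithTop.map_coe]; omega
  | coe m =>
    cases a with
    | top => simp only [WithTop.map_top, WithTop.map_coe]; omega
    | coe n => simp only [WithTop.map_coe]; omega

/-- **Rizzo's reading §1.1–1.2 along `M = C • W_{ℚ₃}`.**  If the valuations of the rational
invariants are the local ones shifted by `(4, 6, 12)·(−k)` — `v₃(c₄) = a − 4k` (or `c₄ = 0`),
`v₃(c₆) = b − 6k` (or `c₆ = 0`), `v₃(Δ) = c − 12k` — then `Rizzo.ofInvariants c₄ c₆ Δ` is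
Table II read on the LOCALLY reduced triple `(a, b, c) − m·(4, 6, 12)`,
`m = KellockDokchitser.shift c b a`, with the residues of the rational invariants.
[cite: Rizzo2003, §1.1–1.2 (pp. 3–4)] -/
theorem ofInvariants_eq_tableII_of_val3 {q₄ q₆ qΔ : ℚ} {a b : WithTop ℤ} {c k : ℤ}
    (h4 : val3 q₄ = a.map fun n => n - 4 * k) (h6 : val3 q₆ = b.map fun n => n - 6 * k)
    (hΔ : padicValRat 3 qΔ = c - 12 * k) :
    ofInvariants q₄ q₆ qΔ =
      tableII (a.map fun n => n - 4 * KellockDokchitser.shift c b a)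
        (b.map fun n => n - 6 * KellockDokchitser.shift c b a)
        (c - 12 * KellockDokchitser.shift c b a) (res9 q₄) (res9 q₆) (res9 qΔ) := by
  unfold ofInvariants
  dsimp only
  rw [hΔ, h6, h4, shift_sub]
  congr 1
  · cases a with
    | top => rfl
    | coe n => simp only [WithTop.map_coe]; congr 1; ring
  · cases b with
    | top => rfl
    | coe n => simp only [WithTop.map_coe]; congr 1; ring
  · ring

/-- `val3` of a non-zero rational, in the shape used above. [cite: Rizzo2003, §1.1 (p. 3)] -/
theorem val3_of_ne_zero {q : ℚ} (hq : q ≠ 0) {n : ℕ} {w : ℕ} {k : ℤ}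
    (h : padicValRat 3 q = (n : ℤ) - w * k) :
    val3 q = ((n : ℤ) : WithTop ℤ).map fun m => m - w * k := by
  simp only [val3, hq, if_false, h, WithTop.map_coe]

end Shift

/-! ### Residues: `res9` versus the class modulo `9` in `ℤ₃` -/

section Residues

/-- In `ℤ/9` a unit has order dividing `6 = φ(9)`. [cite: Rizzo2003, Table II (p. 4), special conditions modulo 9] -/
theorem pow_six_eq_one_of_isUnit_zmod_nine (z : ZMod 9) (hz : IsUnit z) : z ^ 6 = 1 := by
  have key : ∀ z : ZMod 9, (∃ w, z * w = 1) → z ^ 6 = 1 := by decide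
  obtain ⟨w, hw⟩ := hz.exists_right_inv
  exact key z ⟨w, hw⟩

/-- In `ℤ/9`: `3·z⁴ = 3` for a unit `z` (`z⁴ ≡ 1 (mod 3)`). [cite: Rizzo2003, Table II (p. 4), special conditions modulo 9] -/
theorem three_mul_pow_four_mul_of_isUnit_zmod_nine (z x : ZMod 9) (hz : IsUnit z) :
    3 * z ^ 4 * x = 3 * x := by
  have key : ∀ z : ZMod 9, (∃ w, z * w = 1) → 3 * z ^ 4 = 3 := by decide
  obtain ⟨w, hw⟩ := hz.exists_right_inv
  rw [key z ⟨w, hw⟩]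

/-- The prime-to-`3` part `q' = q / 3^{v₃(q)}` of a non-zero rational has `3`-adic valuation `0`:
as an element of `ℚ₃` it has norm `1`. [cite: Rizzo2003, p. 2 (notation x')] -/
theorem norm_primeToThreePart_eq_one {q : ℚ} (hq : q ≠ 0) :
    ‖((primeToThreePart q : ℚ) : ℚ_[3])‖ = 1 := by
  have h3 : (3 : ℚ_[3]) ≠ 0 := by norm_num
  have hq' : (q : ℚ_[3]) ≠ 0 := by exact_mod_cast hq
  have hcast : ((primeToThreePart q : ℚ) : ℚ_[3]) = (q : ℚ_[3]) * (3 : ℚ_[3]) ^ (-padicValRat 3 q) := by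
    unfold primeToThreePart
    push_cast
    rw [zpow_neg, div_eq_mul_inv]
  have hne : ((primeToThreePart q : ℚ) : ℚ_[3]) ≠ 0 := by
    rw [hcast]; exact mul_ne_zero hq' (zpow_ne_zero _ h3)
  have hval : Padic.valuation ((primeToThreePart q : ℚ) : ℚ_[3]) = 0 := by
    rw [hcast, Padic.valuation_mul hq' (zpow_ne_zero _ h3), Padic.valuation_zpow,
      Padic.valuation_ratCast]
    have : Padic.valuation (3 : ℚ_[3]) = 1 := by exact_mod_cast Padic.valuation_p (p := 3)
    rw [this]; ring
  rw [Padic.norm_eq_zpow_neg_valuation hne, hval, neg_zero, zpow_zero]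

/-- **`res9` is the class modulo `9`.**  For `q ≠ 0` let `Q' ∈ ℤ₃` be the prime-to-`3` part
`q' = q/3^{v₃(q)}` (a `3`-adic unit); then `Rizzo.res9 q`, read in `ℤ/9`, is `Q' mod 9`
(`PadicInt.toZModPow 2`): `q' = n/d` with `3 ∤ d`, and `res9` is `n·d⁻¹` in `ℤ/9` by definition.
[cite: Rizzo2003, p. 2 (notation x') and Table II] -/
theorem toZModPow_two_primeToThreePart {q : ℚ} (hq : q ≠ 0)
    (Q : ℤ_[3]) (hQ : (Q : ℚ_[3]) = ((primeToThreePart q : ℚ) : ℚ_[3])) :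
    PadicInt.toZModPow 2 Q = ((res9 q : ℤ) : ZMod (3 ^ 2)) := by
  set q' : ℚ := primeToThreePart q with hq'def
  -- `Q * den = num` in `ℤ₃`
  have hmul : Q * (q'.den : ℤ_[3]) = (q'.num : ℤ_[3]) := by
    apply Subtype.coe_injective
    push_cast
    rw [hQ]
    exact_mod_cast Rat.mul_den_eq_num q'
  -- `3 ∤ den`: otherwise `3 ∣ num` too (from `‖q'‖₃ = 1`), contradicting coprimality
  have hnorm : ‖(Q : ℚ_[3])‖ = 1 := by rw [hQ]; exact norm_primeToThreePart_eq_one hq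
  have hQu : IsUnit Q := PadicInt.isUnit_iff.mpr (by simpa using hnorm)
  have hden : IsUnit ((q'.den : ℕ) : ZMod (3 ^ 2)) := by
    rw [ZMod.isUnit_iff_coprime]
    -- `Nat.Coprime den 9` from `3 ∤ den`
    have h3 : ¬ 3 ∣ q'.den := by
      intro hd
      have hdz : PadicInt.toZMod (q'.den : ℤ_[3]) = 0 := by
        rw [map_natCast, ZMod.natCast_eq_zero_iff]; exact hd
      have hnum : PadicInt.toZMod (q'.num : ℤ_[3]) = 0 := by
        rw [← hmul, map_mul, hdz, mul_zero]
      rw [map_intCast, ZMod.intCast_zmod_eq_zero_iff_dvd] at hnum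
      have hcop := q'.reduced
      have : (3 : ℕ) ∣ Nat.gcd q'.num.natAbs q'.den :=
        Nat.dvd_gcd (by exact_mod_cast Int.natAbs_dvd_natAbs.mpr hnum) hd
      rw [hcop] at this
      omega
    have : Nat.Coprime 3 q'.den := (Nat.Prime.coprime_iff_not_dvd Nat.prime_three).mpr h3
    exact (Nat.Coprime.pow_left 2 this).symm
  have hT : PadicInt.toZModPow 2 Q * ((q'.den : ℕ) : ZMod (3 ^ 2)) = (q'.num : ZMod (3 ^ 2)) := by
    have := congrArg (PadicInt.toZModPow 2) hmul
    rwa [map_mul, map_natCast, map_intCast] at this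
  have hT' : PadicInt.toZModPow 2 Q = (q'.num : ZMod (3 ^ 2)) * ((q'.den : ℕ) : ZMod (3 ^ 2))⁻¹ := by
    rw [← hT, mul_assoc, ZMod.mul_inv_of_unit _ hden, mul_one]
  rw [hT']
  unfold res9
  rw [← hq'def]
  split_ifs with hd
  · rw [show (9 : ℤ) = ((3 ^ 2 : ℕ) : ℤ) by norm_num, ZMod.intCast_mod, hd]; simp
  · push_cast
    rw [ZMod.natCast_zmod_val]


/-- Every non-zero `u ∈ ℚ₃` is `3^{v(u)}` times a unit `u₀ ∈ ℤ₃ˣ`; here `u₀ = u·3^{−v(u)}` as an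
element of `ℤ₃`. [cite: Gouvea1993PadicNumbers, §3.3 (ℤ_p: the valuation v_p, units, p a uniformiser, ℤ_p/pⁿℤ_p ≅ ℤ/pⁿ)] -/
private theorem exists_isUnit_coe_eq_mul_zpow {u : ℚ_[3]} (hu : u ≠ 0) :
    ∃ U : ℤ_[3], IsUnit U ∧ (U : ℚ_[3]) = u * (3 : ℚ_[3]) ^ (-u.valuation) := by
  have h3 : (3 : ℚ_[3]) ≠ 0 := by norm_num
  have hval : Padic.valuation (u * (3 : ℚ_[3]) ^ (-u.valuation)) = 0 := by
    rw [Padic.valuation_mul hu (zpow_ne_zero _ h3), Padic.valuation_zpow]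
    have : Padic.valuation (3 : ℚ_[3]) = 1 := by exact_mod_cast Padic.valuation_p (p := 3)
    rw [this]; ring
  have hnorm : ‖u * (3 : ℚ_[3]) ^ (-u.valuation)‖ = 1 := by
    rw [Padic.norm_eq_zpow_neg_valuation (mul_ne_zero hu (zpow_ne_zero _ h3)), hval, neg_zero,
      zpow_zero]
  exact ⟨PadicInt.mkUnits hnorm, Units.isUnit _, rfl⟩

/-- The prime-to-`3` part of a non-zero rational as a unit of `ℤ₃`. [cite: Rizzo2003, p. 2 (notation x')] -/
theorem exists_isUnit_coe_eq_primeToThreePart {q : ℚ} (hq : q ≠ 0) :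
    ∃ Q : ℤ_[3], IsUnit Q ∧ (Q : ℚ_[3]) = ((primeToThreePart q : ℚ) : ℚ_[3]) :=
  ⟨PadicInt.mkUnits (norm_primeToThreePart_eq_one hq), Units.isUnit _, rfl⟩

/-- **Unit parts along `3^e·X = u^w·q`.**  If `X ∈ ℤ₃`, `u ∈ ℚ₃ˣ`, `q ∈ ℚˣ` with `3^e X = u^w q`
in `ℚ₃` and `v₃(q) = e − w·v(u)` (i.e. `X` is a unit), then `X = (u·3^{−v(u)})^w · q'` with
`q' = q/3^{v₃(q)}` the prime-to-`3` part. [cite: Rizzo2003, §1.2 (p. 4)] -/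
theorem coe_eq_unitPart_mul {X : ℤ_[3]} {u : ℚ_[3]} {w e : ℕ} {q : ℚ}
    (h : (3 : ℚ_[3]) ^ e * (X : ℚ_[3]) = u ^ w * (q : ℚ_[3]))
    (hv : padicValRat 3 q = (e : ℤ) - w * u.valuation) :
    (X : ℚ_[3]) = (u * (3 : ℚ_[3]) ^ (-u.valuation)) ^ w * ((primeToThreePart q : ℚ) : ℚ_[3]) := by
  have h3 : (3 : ℚ_[3]) ≠ 0 := by norm_num
  set k : ℤ := u.valuation with hk
  have hcast : ((primeToThreePart q : ℚ) : ℚ_[3]) = (q : ℚ_[3]) * (3 : ℚ_[3]) ^ (-padicValRat 3 q) := by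
    unfold primeToThreePart
    push_cast
    rw [zpow_neg, div_eq_mul_inv]
  rw [hcast, hv]
  -- compare after multiplying by `3^e`
  have he : (3 : ℚ_[3]) ^ e = (3 : ℚ_[3]) ^ (e : ℤ) := (zpow_natCast _ _).symm
  apply mul_left_cancel₀ (pow_ne_zero e h3)
  rw [h, he, mul_pow, ← zpow_natCast ((3 : ℚ_[3]) ^ (-k)) w, ← zpow_mul]
  -- both sides are `u^w * q` times a power of `3`
  have key : (3 : ℚ_[3]) ^ (e : ℤ) * (u ^ w * (3 : ℚ_[3]) ^ (-k * (w : ℤ)) *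
      ((q : ℚ_[3]) * (3 : ℚ_[3]) ^ (-((e : ℤ) - (w : ℤ) * k)))) =
      u ^ w * (q : ℚ_[3]) * ((3 : ℚ_[3]) ^ (e : ℤ) * (3 : ℚ_[3]) ^ (-k * (w : ℤ)) *
        (3 : ℚ_[3]) ^ (-((e : ℤ) - (w : ℤ) * k))) := by ring
  rw [key, ← zpow_add₀ h3, ← zpow_add₀ h3]
  have hexp : (e : ℤ) + -k * (w : ℤ) + -((e : ℤ) - (w : ℤ) * k) = 0 := by ring
  rw [hexp, zpow_zero, mul_one]

/-- **Unit parts modulo `9`.**  In the situation of `coe_eq_unitPart_mul`, the class of `X` in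
`ℤ/9` is `z^w · res9 q` for a unit `z ∈ (ℤ/9)ˣ` (the class of `u·3^{−v(u)}`).
[cite: Rizzo2003, §1.2 (p. 4) and Table II] -/
theorem exists_toZModPow_two_eq {X : ℤ_[3]} {u : ℚ_[3]} (hu : u ≠ 0) {w e : ℕ} {q : ℚ}
    (hq : q ≠ 0) (h : (3 : ℚ_[3]) ^ e * (X : ℚ_[3]) = u ^ w * (q : ℚ_[3]))
    (hv : padicValRat 3 q = (e : ℤ) - w * u.valuation) :
    ∃ z : ZMod (3 ^ 2), IsUnit z ∧
      PadicInt.toZModPow 2 X = z ^ w * ((res9 q : ℤ) : ZMod (3 ^ 2)) := by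
  obtain ⟨U, hU, hUe⟩ := exists_isUnit_coe_eq_mul_zpow hu
  obtain ⟨Q, hQ, hQe⟩ := exists_isUnit_coe_eq_primeToThreePart hq
  have hX : X = U ^ w * Q := by
    apply Subtype.coe_injective
    push_cast
    rw [hUe, hQe]
    exact coe_eq_unitPart_mul h hv
  refine ⟨PadicInt.toZModPow 2 U, hU.map _, ?_⟩
  rw [hX, map_mul, map_pow, toZModPow_two_primeToThreePart hq Q hQe]

/-- `9 ∣ Y` in `ℤ₃` iff the class of `Y` in `ℤ/9` vanishes. [cite: Gouvea1993PadicNumbers, §3.3 (ℤ_p: the valuation v_p, units, p a uniformiser, ℤ_p/pⁿℤ_p ≅ ℤ/pⁿ)] -/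
private theorem nine_dvd_iff_toZModPow_two_eq_zero (Y : ℤ_[3]) :
    (3 : ℤ_[3]) ^ 2 ∣ Y ↔ PadicInt.toZModPow 2 Y = 0 := by
  rw [← RingHom.mem_ker, PadicInt.ker_toZModPow, Ideal.mem_span_singleton]
  norm_cast

/-- **The special condition read in `ℤ₃`.**  If in `ℤ/9` the class of `C₆` is `res9 c₆` and the
class of `3C₄` is `3·c_{4,e}` (as Table II computes it), then
`9 ∣ C₆² + 2 − 3C₄ ↔ (c₆'² + 2) % 9 = (3c_{4,e}) % 9`. [cite: Rizzo2003, Table II (p. 4), special conditions] -/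
theorem nine_dvd_sq_add_two_sub_iff_emod {C₄ C₆ : ℤ_[3]} {y t : ℤ}
    (h6 : PadicInt.toZModPow 2 C₆ = (y : ZMod (3 ^ 2)))
    (h4 : PadicInt.toZModPow 2 (3 * C₄) = (t : ZMod (3 ^ 2))) :
    (3 : ℤ_[3]) ^ 2 ∣ C₆ ^ 2 + 2 - 3 * C₄ ↔ (y ^ 2 + 2) % 9 = t % 9 := by
  rw [nine_dvd_iff_toZModPow_two_eq_zero, map_sub, map_add, map_pow, h6, h4, map_ofNat,
    sub_eq_zero, show (9 : ℤ) = ((3 ^ 2 : ℕ) : ℤ) by norm_num, ← ZMod.intCast_eq_intCast_iff']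
  push_cast
  rfl

end Residues

end Rizzo

end Literature.NumberTheory.EllipticCurves

end
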